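import Summits.Schanuel.Schanuel.Theorems.RootDecomp1KOnePointCell06

/-!
# RootDecomp1KOnePointCell — lens 1, generation 39 «ONE-POINT ZERO ESTIMATE + LOG-LOG WALL CELL of 33364» ((1, ℓ₂, ℓ₃, ρ) for every log-log-Liouville ρ) — continuation (RootDecomp1KOnePointCell07): §4 `logLogMeasure_cons_two_three`, `logPowMeasure_cons_two_three'`, instances `logLogMeasure_two_three_exp_one (hNW)` / `_pi`; §5 the one-point (log-log) wall cells of 33364 (+ supersession controls); §6 member preliminaries

(lens-1 g39 `RootDecomp1KOnePointCell.lean` [HOME/decomp-schanuel-lens-1/g39/RootDecomp1KOnePointCell.lean sha256 4a1f4bc8…4211, 2530 l + OPprobe + OPctrl + NODE-g39.md; NOTE/CLAIM L1801, ACK + CHECKLIST K-g39 L1803, presearch (6) resolved by the critic L1810, NODE L1824 / REQUEST L1825 / RESULT L1826]; port by census-1 gen 16 in ten parts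
`RootDecomp1KOnePointCell01`–`10` — see the PORT NOTE of part 01; `--supports stmt-Schanuel-33364`; rung 0.)
-/

open Complex IntermediateField Polynomial
open Summit.Schanuel.Schanuel.Theorems.RootDecomp1KHyper
open Summit.Schanuel.Schanuel.Theorems.RootDecomp1KHyper.HyperCell
open Summit.Schanuel.Schanuel.Theorems.RootDecomp1KGeneric
open Summit.Schanuel.Schanuel.Theorems.RootDecomp1KRelLiouvilleCell
open Summit.Schanuel.Schanuel.Theorems.RootDecomp1KLogLogCell
open Summit.Schanuel.Schanuel.Theorems.RootDecomp1KTwoBaseCell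
open Summit.Schanuel.Schanuel.Theorems.RootDecomp1KMeasuredWallCell

namespace Summit.Schanuel.Schanuel.Theorems.RootDecomp1KOnePointCell

section BlockMeasure
open LiouvilleNumber
open scoped Nat

variable {n : ℕ}

/-- **(M′) as a class statement:** `MvPolyMeasure θ ⇒ LogLogMeasure (ℓ₂, ℓ₃, θ)` (tree classes by name). -/
theorem logLogMeasure_cons_two_three {θ : Fin n → ℂ} (hθ : MvPolyMeasure θ) :
    LogLogMeasure (Fin.cons ((liouvilleNumber 2 : ℝ) : ℂ)
      (Fin.cons ((liouvilleNumber 3 : ℝ) : ℂ) θ) : Fin (n + 2) → ℂ) := fun d =>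
  induced_logLog_measure_cons_two_three hθ d

/-- **g38's (M) RE-DERIVED** from (M′) through the class comparison `logPowMeasure_of_logLogMeasure`:
`MvPolyMeasure θ ⇒ LogPowMeasure (ℓ₂, ℓ₃, θ)` — the statement of the tree theorem
`RootDecomp1KMeasuredWallCell.logPowMeasure_cons_two_three`, by a one-scale proof. -/
private theorem logPowMeasure_cons_two_three' {θ : Fin n → ℂ} (hθ : MvPolyMeasure θ) :
    LogPowMeasure (Fin.cons ((liouvilleNumber 2 : ℝ) : ℂ)
      (Fin.cons ((liouvilleNumber 3 : ℝ) : ℂ) θ) : Fin (n + 2) → ℂ) :=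
  logPowMeasure_of_logLogMeasure (logLogMeasure_cons_two_three hθ)

/-- **The concrete log-log triple `(ℓ₂, ℓ₃, e)`** (mod the Nesterenko–Waldschmidt measure of `e`, tree decl
`NWMeasure` BY NAME). -/
theorem logLogMeasure_two_three_exp_one (hNW : NWMeasure) :
    LogLogMeasure ![((liouvilleNumber 2 : ℝ) : ℂ), ((liouvilleNumber 3 : ℝ) : ℂ), cexp 1] :=
  logLogMeasure_cons_two_three (mvPolyMeasure_one_of_polyMeasure (polyMeasure_exp_one_of_NW hNW))

/-- **The concrete log-log triple `(ℓ₂, ℓ₃, π)` — HYPOTHESIS-FREE** (the measure of `π` is tree-proved). -/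
theorem logLogMeasure_two_three_pi :
    LogLogMeasure ![((liouvilleNumber 2 : ℝ) : ℂ), ((liouvilleNumber 3 : ℝ) : ℂ), (Real.pi : ℂ)] :=
  logLogMeasure_cons_two_three (mvPolyMeasure_one_of_polyMeasure polyMeasure_pi)

end BlockMeasure

/-! ## §5  THE ONE-POINT (LOG-LOG) WALL CELL of 33364: `(1, ℓ₂, ℓ₃, ρ)`, `ρ` ANY log-log-Liouville real -/

section Cells
open LiouvilleNumber

/-- **Schanuel's bound on the one-point wall cell, e-version** (mod `hNW : NWMeasure`, tree decl BY NAME):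
for EVERY log-log-Liouville real `ρ` (tree class `LogLogCell.LogLogLiouville`),
`trdeg ℚ(1, ℓ₂, ℓ₃, ρ, e, e^{ℓ₂}, e^{ℓ₃}, e^ρ) ≥ 4`.  The join: the LOG-LOG BLOCK MEASURE (M′) of `(ℓ₂, ℓ₃, e)`
feeds the tree extraction `sb_of_logLogLiouville_of_logLogMeasure` (g35) with `ρ` extracted LAST. -/
theorem sb_onePointCell (hNW : NWMeasure) {ρ : ℝ} (hρ : LogLogLiouville ρ) :
    SB 4 ![(1 : ℂ), ((liouvilleNumber 2 : ℝ) : ℂ), ((liouvilleNumber 3 : ℝ) : ℂ), (ρ : ℂ)] := by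
  refine sb_of_logLogLiouville_of_logLogMeasure (n := 3) hρ ?_
    (logLogMeasure_two_three_exp_one hNW) ?_
  · exact subset_adjoin ℚ _ (Or.inl (Or.inl ⟨3, rfl⟩))
  · intro j
    fin_cases j
    · exact subset_adjoin ℚ _ (Or.inl (Or.inl ⟨1, rfl⟩))
    · exact subset_adjoin ℚ _ (Or.inl (Or.inl ⟨2, rfl⟩))
    · exact subset_adjoin ℚ _ (Or.inl (Or.inr ⟨0, rfl⟩))

/-- **Schanuel's bound on the one-point wall cell, π-version — HYPOTHESIS-FREE**: for every log-log-Liouville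
real `ρ`, `trdeg ℚ(π, πℓ₂, πℓ₃, πρ, e^π, e^{πℓ₂}, e^{πℓ₃}, e^{πρ}) ≥ 4`. -/
theorem sb_onePointCell_pi {ρ : ℝ} (hρ : LogLogLiouville ρ) :
    SB 4 ![(Real.pi : ℂ), (Real.pi : ℂ) * ((liouvilleNumber 2 : ℝ) : ℂ),
      (Real.pi : ℂ) * ((liouvilleNumber 3 : ℝ) : ℂ), (Real.pi : ℂ) * (ρ : ℂ)] := by
  set z : Fin 4 → ℂ := ![(Real.pi : ℂ), (Real.pi : ℂ) * ((liouvilleNumber 2 : ℝ) : ℂ),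
      (Real.pi : ℂ) * ((liouvilleNumber 3 : ℝ) : ℂ), (Real.pi : ℂ) * (ρ : ℂ)] with hz
  have hπ0 : (Real.pi : ℂ) ≠ 0 := by exact_mod_cast Real.pi_ne_zero
  have hz0 : z 0 ∈ adjoin ℚ (SFset z ∪ {I}) := subset_adjoin ℚ _ (Or.inl (Or.inl ⟨0, rfl⟩))
  have hz1 : z 1 ∈ adjoin ℚ (SFset z ∪ {I}) := subset_adjoin ℚ _ (Or.inl (Or.inl ⟨1, rfl⟩))
  have hz2 : z 2 ∈ adjoin ℚ (SFset z ∪ {I}) := subset_adjoin ℚ _ (Or.inl (Or.inl ⟨2, rfl⟩))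
  have hz3 : z 3 ∈ adjoin ℚ (SFset z ∪ {I}) := subset_adjoin ℚ _ (Or.inl (Or.inl ⟨3, rfl⟩))
  have ez0 : z 0 = (Real.pi : ℂ) := rfl
  have ez1 : z 1 = (Real.pi : ℂ) * ((liouvilleNumber 2 : ℝ) : ℂ) := rfl
  have ez2 : z 2 = (Real.pi : ℂ) * ((liouvilleNumber 3 : ℝ) : ℂ) := rfl
  have ez3 : z 3 = (Real.pi : ℂ) * (ρ : ℂ) := rfl
  have eρ : (ρ : ℂ) = z 3 / z 0 := by rw [ez3, ez0, mul_div_cancel_left₀ _ hπ0]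
  have eℓ₂ : ((liouvilleNumber 2 : ℝ) : ℂ) = z 1 / z 0 := by rw [ez1, ez0, mul_div_cancel_left₀ _ hπ0]
  have eℓ₃ : ((liouvilleNumber 3 : ℝ) : ℂ) = z 2 / z 0 := by rw [ez2, ez0, mul_div_cancel_left₀ _ hπ0]
  refine sb_of_logLogLiouville_of_logLogMeasure (n := 3) hρ ?_ logLogMeasure_two_three_pi ?_
  · rw [eρ]; exact div_mem hz3 hz0
  · intro j
    fin_cases j
    · show ((liouvilleNumber 2 : ℝ) : ℂ) ∈ _
      rw [eℓ₂]; exact div_mem hz1 hz0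
    · show ((liouvilleNumber 3 : ℝ) : ℂ) ∈ _
      rw [eℓ₃]; exact div_mem hz2 hz0
    · show (Real.pi : ℂ) ∈ _
      exact hz0

/-- **ITEM 33364 ON THE ONE-POINT WALL CELL (e-version, mod `hNW`).** Binders of
`Summit.Schanuel.Schanuel.Theses.RootDecomp1K.FiniteOrderLiouvilleSchanuel` VERBATIM, with ONE line inserted
after `LinearIndependent ℚ z` — the cell `Set.range z = Set.range (1, ℓ₂, ℓ₃, ρ)`, `ρ` ranging over the
LOG-LOG-LIOUVILLE reals (tree class `LogLogLiouville`, binder `hρ`: CLASS DATA ONLY).  The two Diophantine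
hypotheses are not used (the conclusion holds outright on the cell); they are CERTIFIED at the member `z_P`
(§6).  SUPERSEDES g38's `finiteOrderLiouvilleSchanuel_measuredWallCell` (`LogHyperLiouville ρ`) through the tree
inclusions `LogHyper ⊂ LogSq ⊂ LogLog` (`logLogLiouville_of_logHyperLiouville`, derived below). -/
theorem finiteOrderLiouvilleSchanuel_onePointCell (hNW : NWMeasure) {ρ : ℝ} (hρ : LogLogLiouville ρ) :
    ∀ (n : ℕ) (z : Fin n → ℂ), LinearIndependent ℚ z →
      Set.range z = Set.range ![(1 : ℂ), ((liouvilleNumber 2 : ℝ) : ℂ), ((liouvilleNumber 3 : ℝ) : ℂ),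
        (ρ : ℂ)] →
      (∀ ω : ℕ, ∃ h : Fin n → ℤ, h ≠ 0 ∧ ‖∑ i, (h i : ℂ) * z i‖ < 1 / (1 + ∑ i, (|h i| : ℝ)) ^ ω) →
      (¬ ∀ m : ℕ, ∃ h : Fin n → ℤ, h ≠ 0 ∧
        ‖∑ i, (h i : ℂ) * z i‖ < Real.exp (-((1 + ∑ i, (|h i| : ℝ)) ^ m))) →
      (n : Cardinal) ≤ Algebra.trdeg ℚ
        ↥(IntermediateField.adjoin ℚ (Set.range z ∪ Set.range (Complex.exp ∘ z))) := by
  intro n z hz hrange _ _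
  exact sb_of_range_eq' hz.injective hrange (sb_onePointCell hNW hρ)

/-- **ITEM 33364 ON THE ONE-POINT WALL CELL, π-version — HYPOTHESIS-FREE.** Same binders verbatim, the cell
line `Set.range z = Set.range (π, πℓ₂, πℓ₃, πρ)`, `ρ` log-log-Liouville. -/
theorem finiteOrderLiouvilleSchanuel_onePointCell_pi {ρ : ℝ} (hρ : LogLogLiouville ρ) :
    ∀ (n : ℕ) (z : Fin n → ℂ), LinearIndependent ℚ z →
      Set.range z = Set.range ![(Real.pi : ℂ), (Real.pi : ℂ) * ((liouvilleNumber 2 : ℝ) : ℂ),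
        (Real.pi : ℂ) * ((liouvilleNumber 3 : ℝ) : ℂ), (Real.pi : ℂ) * (ρ : ℂ)] →
      (∀ ω : ℕ, ∃ h : Fin n → ℤ, h ≠ 0 ∧ ‖∑ i, (h i : ℂ) * z i‖ < 1 / (1 + ∑ i, (|h i| : ℝ)) ^ ω) →
      (¬ ∀ m : ℕ, ∃ h : Fin n → ℤ, h ≠ 0 ∧
        ‖∑ i, (h i : ℂ) * z i‖ < Real.exp (-((1 + ∑ i, (|h i| : ℝ)) ^ m))) →
      (n : Cardinal) ≤ Algebra.trdeg ℚ
        ↥(IntermediateField.adjoin ℚ (Set.range z ∪ Set.range (Complex.exp ∘ z))) := by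
  intro n z hz hrange _ _
  exact sb_of_range_eq' hz.injective hrange (sb_onePointCell_pi hρ)

/-- The one-point wall CLASS: `z` is a re-indexing of `(1, ℓ₂, ℓ₃, ρ)` for SOME log-log-Liouville real `ρ`
(class data only). -/
def InOnePointWallClass {n : ℕ} (z : Fin n → ℂ) : Prop :=
  ∃ ρ : ℝ, LogLogLiouville ρ ∧
    Set.range z = Set.range ![(1 : ℂ), ((liouvilleNumber 2 : ℝ) : ℂ), ((liouvilleNumber 3 : ℝ) : ℂ), (ρ : ℂ)]

/-- The π-twin class. -/
def InOnePointWallClassPi {n : ℕ} (z : Fin n → ℂ) : Prop :=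
  ∃ ρ : ℝ, LogLogLiouville ρ ∧
    Set.range z = Set.range ![(Real.pi : ℂ), (Real.pi : ℂ) * ((liouvilleNumber 2 : ℝ) : ℂ),
      (Real.pi : ℂ) * ((liouvilleNumber 3 : ℝ) : ℂ), (Real.pi : ℂ) * (ρ : ℂ)]

/-- g38's measured wall class is INSIDE the one-point wall class (`LogHyper ⊂ LogLog`). -/
theorem inOnePointWallClass_of_inMeasuredWallClass {n : ℕ} {z : Fin n → ℂ}
    (h : InMeasuredWallClass z) : InOnePointWallClass z :=
  let ⟨ρ, hρ, hr⟩ := h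
  ⟨ρ, logLogLiouville_of_logHyperLiouville hρ, hr⟩

/-- π-twin inclusion. -/
theorem inOnePointWallClassPi_of_inMeasuredWallClassPi {n : ℕ} {z : Fin n → ℂ}
    (h : InMeasuredWallClassPi z) : InOnePointWallClassPi z :=
  let ⟨ρ, hρ, hr⟩ := h
  ⟨ρ, logLogLiouville_of_logHyperLiouville hρ, hr⟩

/-- **ITEM 33364 ON THE ONE-POINT WALL CLASS (mod `hNW`)** — binders verbatim + the ONE class line
`InOnePointWallClass z`. -/
theorem finiteOrderLiouvilleSchanuel_of_inOnePointWallClass (hNW : NWMeasure) :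
    ∀ (n : ℕ) (z : Fin n → ℂ), LinearIndependent ℚ z → InOnePointWallClass z →
      (∀ ω : ℕ, ∃ h : Fin n → ℤ, h ≠ 0 ∧ ‖∑ i, (h i : ℂ) * z i‖ < 1 / (1 + ∑ i, (|h i| : ℝ)) ^ ω) →
      (¬ ∀ m : ℕ, ∃ h : Fin n → ℤ, h ≠ 0 ∧
        ‖∑ i, (h i : ℂ) * z i‖ < Real.exp (-((1 + ∑ i, (|h i| : ℝ)) ^ m))) →
      (n : Cardinal) ≤ Algebra.trdeg ℚ
        ↥(IntermediateField.adjoin ℚ (Set.range z ∪ Set.range (Complex.exp ∘ z))) := by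
  rintro n z hz ⟨ρ, hρ, hrange⟩ hω hm
  exact finiteOrderLiouvilleSchanuel_onePointCell hNW hρ n z hz hrange hω hm

/-- **ITEM 33364 ON THE ONE-POINT WALL π-CLASS — HYPOTHESIS-FREE.** -/
theorem finiteOrderLiouvilleSchanuel_of_inOnePointWallClassPi :
    ∀ (n : ℕ) (z : Fin n → ℂ), LinearIndependent ℚ z → InOnePointWallClassPi z →
      (∀ ω : ℕ, ∃ h : Fin n → ℤ, h ≠ 0 ∧ ‖∑ i, (h i : ℂ) * z i‖ < 1 / (1 + ∑ i, (|h i| : ℝ)) ^ ω) →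
      (¬ ∀ m : ℕ, ∃ h : Fin n → ℤ, h ≠ 0 ∧
        ‖∑ i, (h i : ℂ) * z i‖ < Real.exp (-((1 + ∑ i, (|h i| : ℝ)) ^ m))) →
      (n : Cardinal) ≤ Algebra.trdeg ℚ
        ↥(IntermediateField.adjoin ℚ (Set.range z ∪ Set.range (Complex.exp ∘ z))) := by
  rintro n z hz ⟨ρ, hρ, hrange⟩ hω hm
  exact finiteOrderLiouvilleSchanuel_onePointCell_pi hρ n z hz hrange hω hm

/-! ### Supersession: the earlier wall cells DERIVED from the one-point cell (positive controls, not claims) -/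

/-- g38's MEASURED wall cell (`LogHyperLiouville ρ`) DERIVED — same statement as the tree theorem
`RootDecomp1KMeasuredWallCell.finiteOrderLiouvilleSchanuel_measuredWallCell`, via `LogHyper ⊂ LogLog`. -/
private theorem finiteOrderLiouvilleSchanuel_measuredWallCell' (hNW : NWMeasure) {ρ : ℝ}
    (hρ : LogHyperLiouville ρ) :
    ∀ (n : ℕ) (z : Fin n → ℂ), LinearIndependent ℚ z →
      Set.range z = Set.range ![(1 : ℂ), ((liouvilleNumber 2 : ℝ) : ℂ), ((liouvilleNumber 3 : ℝ) : ℂ),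
        (ρ : ℂ)] →
      (∀ ω : ℕ, ∃ h : Fin n → ℤ, h ≠ 0 ∧ ‖∑ i, (h i : ℂ) * z i‖ < 1 / (1 + ∑ i, (|h i| : ℝ)) ^ ω) →
      (¬ ∀ m : ℕ, ∃ h : Fin n → ℤ, h ≠ 0 ∧
        ‖∑ i, (h i : ℂ) * z i‖ < Real.exp (-((1 + ∑ i, (|h i| : ℝ)) ^ m))) →
      (n : Cardinal) ≤ Algebra.trdeg ℚ
        ↥(IntermediateField.adjoin ℚ (Set.range z ∪ Set.range (Complex.exp ∘ z))) :=
  finiteOrderLiouvilleSchanuel_onePointCell hNW (logLogLiouville_of_logHyperLiouville hρ)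

/-- The LOG-SQUARE wall cell (`LogSqLiouville ρ`) DERIVED via `LogSq ⊂ LogLog` (`logLogLiouville_of_logSqLiouville`). -/
theorem finiteOrderLiouvilleSchanuel_logSqWallCell (hNW : NWMeasure) {ρ : ℝ} (hρ : LogSqLiouville ρ) :
    ∀ (n : ℕ) (z : Fin n → ℂ), LinearIndependent ℚ z →
      Set.range z = Set.range ![(1 : ℂ), ((liouvilleNumber 2 : ℝ) : ℂ), ((liouvilleNumber 3 : ℝ) : ℂ),
        (ρ : ℂ)] →
      (∀ ω : ℕ, ∃ h : Fin n → ℤ, h ≠ 0 ∧ ‖∑ i, (h i : ℂ) * z i‖ < 1 / (1 + ∑ i, (|h i| : ℝ)) ^ ω) →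
      (¬ ∀ m : ℕ, ∃ h : Fin n → ℤ, h ≠ 0 ∧
        ‖∑ i, (h i : ℂ) * z i‖ < Real.exp (-((1 + ∑ i, (|h i| : ℝ)) ^ m))) →
      (n : Cardinal) ≤ Algebra.trdeg ℚ
        ↥(IntermediateField.adjoin ℚ (Set.range z ∪ Set.range (Complex.exp ∘ z))) :=
  finiteOrderLiouvilleSchanuel_onePointCell hNW (logLogLiouville_of_logSqLiouville hρ)

/-- The HYPER-Liouville wall cell (`HyperLiouville ρ`, g30's class) DERIVED via `Hyper ⊂ LogLog`
(`logLogLiouville_of_hyperLiouville`); π-version, hypothesis-free. -/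
theorem finiteOrderLiouvilleSchanuel_hyperWallCell_pi {ρ : ℝ} (hρ : HyperLiouville ρ) :
    ∀ (n : ℕ) (z : Fin n → ℂ), LinearIndependent ℚ z →
      Set.range z = Set.range ![(Real.pi : ℂ), (Real.pi : ℂ) * ((liouvilleNumber 2 : ℝ) : ℂ),
        (Real.pi : ℂ) * ((liouvilleNumber 3 : ℝ) : ℂ), (Real.pi : ℂ) * (ρ : ℂ)] →
      (∀ ω : ℕ, ∃ h : Fin n → ℤ, h ≠ 0 ∧ ‖∑ i, (h i : ℂ) * z i‖ < 1 / (1 + ∑ i, (|h i| : ℝ)) ^ ω) →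
      (¬ ∀ m : ℕ, ∃ h : Fin n → ℤ, h ≠ 0 ∧
        ‖∑ i, (h i : ℂ) * z i‖ < Real.exp (-((1 + ∑ i, (|h i| : ℝ)) ^ m))) →
      (n : Cardinal) ≤ Algebra.trdeg ℚ
        ↥(IntermediateField.adjoin ℚ (Set.range z ∪ Set.range (Complex.exp ∘ z))) :=
  finiteOrderLiouvilleSchanuel_onePointCell_pi (logLogLiouville_of_hyperLiouville hρ)

end Cells

/-! ## §6  THE MEMBER `z_P = (1, ℓ₂, ℓ₃, ρ_E)`: 33364's hypotheses CERTIFIED, item APPLIED, SEPARATION -/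

section MemberPrelim
open LiouvilleNumber
open scoped Nat

/-- Upper bound for the tail in base `m ≥ 2`: `r_k ≤ 2·m^{-(k+1)!}`. -/
private theorem remainder_le' {m : ℝ} (hm : 2 ≤ m) (k : ℕ) : remainder m k ≤ 2 / m ^ (k + 1)! := by
  have m1 : (1 : ℝ) < m := by linarith
  have h := remainder_lt' k m1
  have hhalf : (1 : ℝ) / m ≤ 1 / 2 := one_div_le_one_div_of_le two_pos hm
  have hpos : (0 : ℝ) < 1 - 1 / m := by linarith
  have hinv : (1 - 1 / m)⁻¹ ≤ 2 := by
    rw [inv_le_comm₀ hpos two_pos]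
    linarith
  have hmk : (0 : ℝ) < 1 / m ^ (k + 1)! := by positivity
  calc remainder m k ≤ (1 - 1 / m)⁻¹ * (1 / m ^ (k + 1)!) := h.le
    _ ≤ 2 * (1 / m ^ (k + 1)!) := mul_le_mul_of_nonneg_right hinv hmk.le
    _ = 2 / m ^ (k + 1)! := by ring

/-- `6 ≤ e²`. -/
private theorem six_le_exp_two' : (6 : ℝ) ≤ Real.exp 2 := by
  have h : Real.exp 2 = Real.exp 1 ^ 2 := by rw [← Real.exp_nat_mul]; norm_num
  rw [h]
  have h1 := Real.exp_one_gt_d9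
  calc (6 : ℝ) ≤ (2.7182818283 : ℝ) ^ 2 := by norm_num
    _ ≤ Real.exp 1 ^ 2 := pow_le_pow_left₀ (by norm_num) h1.le 2

/-! ## §6  The member `z_P = (1, ℓ₂, ℓ₃, ρ_E)` and its π-twin `z_P^π`: scope certificates (hypothesis-free) -/

end MemberPrelim

end Summit.Schanuel.Schanuel.Theorems.RootDecomp1KOnePointCell
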